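import Summits.HodgeConjecture.HodgeConjecture.Theorems.H413OmegaAtLineToModel
import Literature.NumberTheory.GelbartRogawski1991.UnitaryDualPairWeilCoinvariantsReference
import Literature.NumberTheory.GelbartRogawski1991.UnitaryDualPairWeilCoinvariantsSmooth
import HarnessLib

/-!
# FLOOR-0 P4, seat S4′(i) ∕ S4b, step (1d) — the junction twist IS the finite part of a RATIONALLY TRIVIAL ADELIC pair character
# ([GelbartRogawski1991, §3.1 Remark p. 457]: two compatible splittings differ by an automorphic character)

Cell hodgecm-mathlib (D-0151), FLOOR 0, crux item H413 = stmt-HodgeConjecture-24833; P4 line (ed. 2), stub S4b.  Author F0P4-p01 (g0) (seat (i)); SEAT-i MEMO v4.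
`--supports stmt-HodgeConjecture-24833 --as helper`.  DEF-FREE.  HC_CM is proved only modulo the printed citations until rung 0 closes.

★ p796264 ∕ p796716 produced the junction `Ψ` with a FINITE twist `χtw` (existential).  The knob (★ `exists_knob`, `H413CharacterKnobSolve`) wants the
`U(V)`-part of the twist to be the finite part of a rationally trivial continuous ADELIC character.  Here: the `μ`-splitting `chiSplitting θ` and the model's
chosen splitting `splittingOf h` are BOTH compatible, so `chiSplitting θ = splittingOf h ⊗ ĉ` for an adelic pair character `ĉ` trivial on `G₁(L⁺)` and continuous
(★ `exists_eq_twist_of_isCompatible`); restricting to the finite pair (`pairSmall₁_twist_comp_finPairToAdelic`, via `adelicMpContReindex_symm_ofScalar`) the finite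
twist is `ĉ ∘ ι_pair ∘ finPairToAdelic`, and (1b) is re-run with THIS twist:
`exists_coinv_equiv_chiSplitting_splittingOf_adelic` — (1b) with `χtw := ĉ ∘ ι_pair ∘ finPairToAdelic`, exporting `chiSplitting = splittingOf h ⊗ ĉ`,
`ĉ (ι_V γ) = 1` on `U(diag dV)(L⁺)`, `ĉ (ι_W γ) = 1` on `U(diag dW)(L⁺)`, `Continuous ĉ`; `comp_pairEmbFin_apply_inl ∕ _inr` read the finite twist on the two
members (`λ k = ĉ (ι_V k_𝔸)`), so that ★ `exists_knob` applies with `κ := ĉ ∘ ι_V`.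

## References
* [GelbartRogawski1991] S. Gelbart, J. Rogawski, Invent. Math. 105 (1991), §3.1 Prop. 3.1.1 p. 455; Remark p. 457 L4–13.
* [Liu2021] Y. Liu, Camb. J. Math. 9 (2021), Def. 4.11; App. D §D.1 Steps 1–3 (l. 5217–5221).
* [MoeglinVignerasWaldspurger1987] C. Mœglin, M.-F. Vignéras, J.-L. Waldspurger, LNM 1291, Chap. 2 II.1 (A)–(B).
-/

set_option autoImplicit false
set_option linter.dupNamespace false

noncomputable section

open scoped Matrix Kronecker
open NumberField IsDedekindDomain
open Literature.NumberTheory.Automorphic Literature.NumberTheory.Automorphic.UnitaryGroup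
open Literature.NumberTheory.Weil1964
open Literature.NumberTheory.GelbartRogawski1991 Literature.NumberTheory.GelbartRogawski1991.UnitaryDualPair
open Literature.NumberTheory.GelbartRogawski1991.UnitaryDualPair.WeilCoinv
open Literature.NumberTheory.Automorphic.Liu2021.Def411WeilCarriersDoubling
open Literature.NumberTheory.GelbartRogawski1991.GRConstruction (Fp)
open Literature.NumberTheory.GaloisRepresentations (HeckeCharacter)
open Literature.RepresentationTheory.HarrisKudlaSweet1996 (IsSplittingChar)

namespace Summit.HodgeConjecture.HodgeConjecture.Cruxes.H413.ThetaJunction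

/-! ## §0 Two structural lemmas: reindexing fixes the central scalars; restricting an adelic twist to the finite pair -/

section Reindex

variable (F : Type) [Field F] [NumberField F] {ι ι' : Type} [Fintype ι] [Fintype ι'] [DecidableEq ι] [DecidableEq ι']
  (e : ι ≃ ι') (T : Matrix ι ι (AdeleRing (𝓞 F) F))

/-- the reindexing of record fixes the central scalars: `R_e (1, z·id) R_e⁻¹ = (1, z·id)`. [cite: MoeglinVignerasWaldspurger1987, Chap. 2 II.1 (B)] -/
theorem adelicMpContReindex_ofScalar (z : ℂˣ) :
    adelicMpContReindex F e T (adelicMpCont.ofScalar F ι T z) = adelicMpCont.ofScalar F ι' (Matrix.reindex e e T) z :=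
  adelicMpCont.eq_ofScalar_of_forall_omega_eq _
    (by rw [adelicMpCont.proj_reindex, adelicMpCont.proj_ofScalar, map_one]) z
    (fun Ψ => by rw [adelicMpCont.omega_reindex_apply, adelicMpCont.omega_ofScalar, map_smul, LinearEquiv.apply_symm_apply])

/-- … hence so does its inverse. [cite: MoeglinVignerasWaldspurger1987, Chap. 2 II.1 (B)] -/
theorem adelicMpContReindex_symm_ofScalar (z : ℂˣ) :
    (adelicMpContReindex F e T).symm (adelicMpCont.ofScalar F ι' (Matrix.reindex e e T) z) = adelicMpCont.ofScalar F ι T z := by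
  rw [MulEquiv.symm_apply_eq]
  exact (adelicMpContReindex_ofScalar F e T z).symm

end Reindex

section TwistRestrict

variable (F E : Type) [Field F] [NumberField F] [Field E] [NumberField E] [Algebra F E] (c : E ≃ₐ[F] E) (N M : ℕ) {n : ℕ}
  (e : Fin N × Fin M ≃ Fin n) (JV : Matrix (Fin N) (Fin N) E) (JW : Matrix (Fin M) (Fin M) E)
  {TV : Matrix (Fin N) (Fin N) F} {TW : Matrix (Fin M) (Fin M) F}

/-- **restricting an adelic twist to the finite pair**: `pairSmall₁ (s ⊗ ĉ) ∘ fin = (pairSmall₁ s ∘ fin) ⊗ (ĉ ∘ ι_pair ∘ fin)`.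
[cite: GelbartRogawski1991, §3.1 Remark p. 457 L4–13] -/
theorem pairSmall₁_twist_comp_finPairToAdelic
    (s : UnitaryGroup.adelicPair F E c N M JV JW →* adelicMpCont F (Fin n) (adelicGram F e TV TW))
    (ĉ : UnitaryGroup.adelicPair F E c N M JV JW →* ℂˣ) :
    (pairSmall₁ F E c N M e JV JW (adelicMpCont.twist F (Fin n) (adelicGram F e TV TW) s ĉ)).comp (finPairToAdelic F E c N M JV JW) =
      adelicMpCont.twist F (Fin N × Fin M) _ ((pairSmall₁ F E c N M e JV JW s).comp (finPairToAdelic F E c N M JV JW))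
        (ĉ.comp ((MonoidHom.noncommCoprod (UnitaryGroup.adelicInl F E c N M JV JW) (UnitaryGroup.adelicInr F E c N M JV JW)
          (UnitaryGroup.commute_adelicInl_adelicInr F E c N M JV JW)).comp (finPairToAdelic F E c N M JV JW))) := by
  refine MonoidHom.ext fun q => ?_
  exact (map_mul (adelicMpContReindex F e _).symm _ _).trans (congrArg (· * _) (adelicMpContReindex_symm_ofScalar F e _ _))

/-- the finite twist on `U(J_V)(𝔸_f) × 1`: `(ĉ ∘ ι_pair ∘ fin) (k, 1) = ĉ (ι_V k_𝔸)`. [folklore] -/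
theorem comp_pairEmbFin_apply_inl (ĉ : UnitaryGroup.adelicPair F E c N M JV JW →* ℂˣ) (k : UnitaryGroup.finAdelic F E c N JV) :
    (ĉ.comp ((MonoidHom.noncommCoprod (UnitaryGroup.adelicInl F E c N M JV JW) (UnitaryGroup.adelicInr F E c N M JV JW)
        (UnitaryGroup.commute_adelicInl_adelicInr F E c N M JV JW)).comp (finPairToAdelic F E c N M JV JW))) (k, 1) =
      ĉ (UnitaryGroup.adelicInl F E c N M JV JW (UnitaryGroup.finAdelicToAdelic F E c N JV k)) := by
  simp only [MonoidHom.coe_comp, Function.comp_apply, finPairToAdelic_apply, map_one, MonoidHom.noncommCoprod_apply]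
  erw [map_one (UnitaryGroup.adelicInr F E c N M JV JW)]
  rw [mul_one]

/-- the finite twist on `1 × U(J_W)(𝔸_f)`: `(ĉ ∘ ι_pair ∘ fin) (1, u) = ĉ (ι_W u_𝔸)`. [folklore] -/
theorem comp_pairEmbFin_apply_inr (ĉ : UnitaryGroup.adelicPair F E c N M JV JW →* ℂˣ) (u : UnitaryGroup.finAdelic F E c M JW) :
    (ĉ.comp ((MonoidHom.noncommCoprod (UnitaryGroup.adelicInl F E c N M JV JW) (UnitaryGroup.adelicInr F E c N M JV JW)
        (UnitaryGroup.commute_adelicInl_adelicInr F E c N M JV JW)).comp (finPairToAdelic F E c N M JV JW))) (1, u) =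
      ĉ (UnitaryGroup.adelicInr F E c N M JV JW (UnitaryGroup.finAdelicToAdelic F E c M JW u)) := by
  simp only [MonoidHom.coe_comp, Function.comp_apply, finPairToAdelic_apply, map_one, MonoidHom.noncommCoprod_apply]
  erw [map_one (UnitaryGroup.adelicInl F E c N M JV JW)]
  rw [one_mul]

end TwistRestrict

/-! ## §1 Step (1b) with the ADELIC twist -/

variable (L : Type) [Field L] [NumberField L] [IsCMField L] {N' n' : ℕ} (e₁ : Fin N' × Fin 1 ≃ Fin n')
  (dV₁ : Fin N' → L) (hdV₁ : ∀ i, IsCMField.complexConj L (dV₁ i) = dV₁ i) (hdV₁0 : ∀ i, dV₁ i ≠ 0)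
  (dW : Fin 1 → L) (hdW : ∀ i, IsCMField.complexConj L (dW i) = dW i) (hdW0 : ∀ i, dW i ≠ 0)
  (θ : HeckeCharacter L) (hθu : θ.IsUnitary) (hθs : IsSplittingChar L 1 θ)
  (h : (splittingDatum (Fp L) L (IsCMField.complexConj L) N' 1 e₁ (Matrix.diagonal dV₁) (Matrix.diagonal dW) (complexConj_imagUnit L)
      (imagUnit_ne_zero L) (imagUnit_mul_self L) (realDiagonal_isSymm L dV₁ hdV₁) (realDiagonal_isSymm L dW hdW)
      (isUnit_det_realDiagonal L dV₁ hdV₁ hdV₁0) (isUnit_det_realDiagonal L dW hdW hdW0) (realDiagonal_map L dV₁ hdV₁).symm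
      (realDiagonal_map L dW hdW).symm).CompatibleSplitting)
  (χ' : UnitaryGroup.finAdelic (Fp L) L (IsCMField.complexConj L) 1 (Matrix.diagonal dW) →* ℂˣ)

set_option maxHeartbeats 4000000 in
/-- **step (1b), adelic form**: see the module docstring. [cite: GelbartRogawski1991, §3.1 Prop. 3.1.1 p. 455; Remark p. 457 L4–13] [cite: Liu2021, App. D §D.1 Steps 1–3 (l. 5217–5221)] -/
theorem exists_coinv_equiv_chiSplitting_splittingOf_adelic :
    ∃ ĉ : UnitaryGroup.adelicPair (Fp L) L (IsCMField.complexConj L) N' 1 (Matrix.diagonal dV₁) (Matrix.diagonal dW) →* ℂˣ,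
      chiSplitting L e₁ dV₁ hdV₁ hdV₁0 dW hdW hdW0 θ hθu hθs =
          adelicMpCont.twist (Fp L) (Fin n') _ (splittingOf _ _ _ _ _ _ _ _ _ _ _ _ _ _ _ _ _ h) ĉ ∧
      (∀ γU ∈ (UnitaryGroup.toAdelic (Fp L) L (IsCMField.complexConj L) N' (Matrix.diagonal dV₁)).range,
          ĉ (UnitaryGroup.adelicInl (Fp L) L (IsCMField.complexConj L) N' 1 (Matrix.diagonal dV₁) (Matrix.diagonal dW) γU) = 1) ∧
      (∀ γ ∈ (UnitaryGroup.toAdelic (Fp L) L (IsCMField.complexConj L) 1 (Matrix.diagonal dW)).range,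
          ĉ (UnitaryGroup.adelicInr (Fp L) L (IsCMField.complexConj L) N' 1 (Matrix.diagonal dV₁) (Matrix.diagonal dW) γ) = 1) ∧
      Continuous ĉ ∧
      ∃ T : Literature.RepresentationTheory.TwistedCoinv.Coinv
            (finPairRepW (Fp L) L (IsCMField.complexConj L) N' 1 e₁ (Matrix.diagonal dV₁) (Matrix.diagonal dW) (complexConj_imagUnit L)
              (imagUnit_ne_zero L) (imagUnit_mul_self L) (realDiagonal_isSymm L dV₁ hdV₁) (realDiagonal_isSymm L dW hdW)
              (isUnit_det_realDiagonal L dV₁ hdV₁ hdV₁0) (isUnit_det_realDiagonal L dW hdW hdW0) (realDiagonal_map L dV₁ hdV₁).symm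
              (realDiagonal_map L dW hdW).symm (isCompatible_chiSplitting L e₁ dV₁ hdV₁ hdV₁0 dW hdW hdW0 θ hθu hθs)) χ' ≃ₗ[ℂ]
          Literature.RepresentationTheory.TwistedCoinv.Coinv
            ((finPairRep (Fp L) L (IsCMField.complexConj L) N' 1 e₁ (Matrix.diagonal dV₁) (Matrix.diagonal dW) (complexConj_imagUnit L)
              (imagUnit_ne_zero L) (imagUnit_mul_self L) (realDiagonal_isSymm L dV₁ hdV₁) (realDiagonal_isSymm L dW hdW)
              (isUnit_det_realDiagonal L dV₁ hdV₁ hdV₁0) (isUnit_det_realDiagonal L dW hdW hdW0) (realDiagonal_map L dV₁ hdV₁).symm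
              (realDiagonal_map L dW hdW).symm
              (splittingOf_isCompatible _ _ _ _ _ _ _ _ _ _ _ _ _ _ _ _ _ h)).comp (MonoidHom.inr _ _))
            (((ĉ.comp
          ((MonoidHom.noncommCoprod (UnitaryGroup.adelicInl (Fp L) L (IsCMField.complexConj L) N' 1 (Matrix.diagonal dV₁) (Matrix.diagonal dW))
              (UnitaryGroup.adelicInr (Fp L) L (IsCMField.complexConj L) N' 1 (Matrix.diagonal dV₁) (Matrix.diagonal dW))
              (UnitaryGroup.commute_adelicInl_adelicInr (Fp L) L (IsCMField.complexConj L) N' 1 (Matrix.diagonal dV₁) (Matrix.diagonal dW))).comp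
            (finPairToAdelic (Fp L) L (IsCMField.complexConj L) N' 1 (Matrix.diagonal dV₁) (Matrix.diagonal dW)))).comp (MonoidHom.inr _ _))⁻¹ * χ'),
        (∀ f, T (Literature.RepresentationTheory.TwistedCoinv.mk _ χ' f) = Literature.RepresentationTheory.TwistedCoinv.mk _ _ f) ∧
        ∀ (k : UnitaryGroup.finAdelic (Fp L) L (IsCMField.complexConj L) N' (Matrix.diagonal dV₁)) x,
          T (weilCoinv (Fp L) L (IsCMField.complexConj L) N' 1 e₁ (Matrix.diagonal dV₁) (Matrix.diagonal dW) (complexConj_imagUnit L)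
              (imagUnit_ne_zero L) (imagUnit_mul_self L) (realDiagonal_isSymm L dV₁ hdV₁) (realDiagonal_isSymm L dW hdW)
              (isUnit_det_realDiagonal L dV₁ hdV₁ hdV₁0) (isUnit_det_realDiagonal L dW hdW hdW0) (realDiagonal_map L dV₁ hdV₁).symm
              (realDiagonal_map L dW hdW).symm χ' (isCompatible_chiSplitting L e₁ dV₁ hdV₁ hdV₁0 dW hdW hdW0 θ hθu hθs) k x) =
            (((ĉ.comp
          ((MonoidHom.noncommCoprod (UnitaryGroup.adelicInl (Fp L) L (IsCMField.complexConj L) N' 1 (Matrix.diagonal dV₁) (Matrix.diagonal dW))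
              (UnitaryGroup.adelicInr (Fp L) L (IsCMField.complexConj L) N' 1 (Matrix.diagonal dV₁) (Matrix.diagonal dW))
              (UnitaryGroup.commute_adelicInl_adelicInr (Fp L) L (IsCMField.complexConj L) N' 1 (Matrix.diagonal dV₁) (Matrix.diagonal dW))).comp
            (finPairToAdelic (Fp L) L (IsCMField.complexConj L) N' 1 (Matrix.diagonal dV₁) (Matrix.diagonal dW)))) (k, 1) : ℂˣ) : ℂ) •
              Literature.RepresentationTheory.TwistedCoinv.rep (((ĉ.comp
          ((MonoidHom.noncommCoprod (UnitaryGroup.adelicInl (Fp L) L (IsCMField.complexConj L) N' 1 (Matrix.diagonal dV₁) (Matrix.diagonal dW))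
              (UnitaryGroup.adelicInr (Fp L) L (IsCMField.complexConj L) N' 1 (Matrix.diagonal dV₁) (Matrix.diagonal dW))
              (UnitaryGroup.commute_adelicInl_adelicInr (Fp L) L (IsCMField.complexConj L) N' 1 (Matrix.diagonal dV₁) (Matrix.diagonal dW))).comp
            (finPairToAdelic (Fp L) L (IsCMField.complexConj L) N' 1 (Matrix.diagonal dV₁) (Matrix.diagonal dW)))).comp (MonoidHom.inr _ _))⁻¹ * χ')
                ((finPairRep (Fp L) L (IsCMField.complexConj L) N' 1 e₁ (Matrix.diagonal dV₁) (Matrix.diagonal dW) (complexConj_imagUnit L)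
                  (imagUnit_ne_zero L) (imagUnit_mul_self L) (realDiagonal_isSymm L dV₁ hdV₁) (realDiagonal_isSymm L dW hdW)
                  (isUnit_det_realDiagonal L dV₁ hdV₁ hdV₁0) (isUnit_det_realDiagonal L dW hdW hdW0) (realDiagonal_map L dV₁ hdV₁).symm
                  (realDiagonal_map L dW hdW).symm
                  (splittingOf_isCompatible _ _ _ _ _ _ _ _ _ _ _ _ _ _ _ _ _ h)).comp (MonoidHom.inl _ _))
                (commute_comp_inl_comp_inr _) k (T x) := by
  have hs := isCompatible_chiSplitting L e₁ dV₁ hdV₁ hdV₁0 dW hdW hdW0 θ hθu hθs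
  have hs' := splittingOf_isCompatible (Fp L) L (IsCMField.complexConj L) N' 1 e₁ (Matrix.diagonal dV₁) (Matrix.diagonal dW)
    (complexConj_imagUnit L) (imagUnit_ne_zero L) (imagUnit_mul_self L) (realDiagonal_isSymm L dV₁ hdV₁) (realDiagonal_isSymm L dW hdW)
    (isUnit_det_realDiagonal L dV₁ hdV₁ hdV₁0) (isUnit_det_realDiagonal L dW hdW hdW0) (realDiagonal_map L dV₁ hdV₁).symm
    (realDiagonal_map L dW hdW).symm h
  -- the reference section: the finite restriction of the model's chosen splitting; same symplectic map as the μ-splitting's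
  have hproj : ∀ p, adelicMpCont.proj (Fp L) (Fin N' × Fin 1) _
      (((pairSmall₁ (Fp L) L (IsCMField.complexConj L) N' 1 e₁ (Matrix.diagonal dV₁) (Matrix.diagonal dW) (splittingOf _ _ _ _ _ _ _ _ _ _ _ _ _ _ _ _ _ h)).comp
        (finPairToAdelic (Fp L) L (IsCMField.complexConj L) N' 1 (Matrix.diagonal dV₁) (Matrix.diagonal dW))) p) =
      adelicMpCont.proj (Fp L) (Fin N' × Fin 1) _
        (((pairSmall₁ (Fp L) L (IsCMField.complexConj L) N' 1 e₁ (Matrix.diagonal dV₁) (Matrix.diagonal dW)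
            (chiSplitting L e₁ dV₁ hdV₁ hdV₁0 dW hdW hdW0 θ hθu hθs)).comp
          (finPairToAdelic (Fp L) L (IsCMField.complexConj L) N' 1 (Matrix.diagonal dV₁) (Matrix.diagonal dW))) p) := fun p =>
    (proj_pairSmall₁ (Fp L) L (IsCMField.complexConj L) N' 1 e₁ (Matrix.diagonal dV₁) (Matrix.diagonal dW) _ _ _ _ _ _ _ _ _ hs' _).trans
      (proj_pairSmall₁ (Fp L) L (IsCMField.complexConj L) N' 1 e₁ (Matrix.diagonal dV₁) (Matrix.diagonal dW) _ _ _ _ _ _ _ _ _ hs _).symm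
  obtain ⟨ĉ, hĉ, hĉrat, hĉc⟩ := exists_eq_twist_of_isCompatible (Fp L) L (IsCMField.complexConj L) N' 1 e₁ (Matrix.diagonal dV₁)
    (Matrix.diagonal dW) _ _ _ _ _ _ _ _ _ hs' hs
  have hχtw : (pairSmall₁ (Fp L) L (IsCMField.complexConj L) N' 1 e₁ (Matrix.diagonal dV₁) (Matrix.diagonal dW)
        (chiSplitting L e₁ dV₁ hdV₁ hdV₁0 dW hdW hdW0 θ hθu hθs)).comp
      (finPairToAdelic (Fp L) L (IsCMField.complexConj L) N' 1 (Matrix.diagonal dV₁) (Matrix.diagonal dW)) =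
      adelicMpCont.twist (Fp L) (Fin N' × Fin 1) _
        ((pairSmall₁ (Fp L) L (IsCMField.complexConj L) N' 1 e₁ (Matrix.diagonal dV₁) (Matrix.diagonal dW)
          (splittingOf _ _ _ _ _ _ _ _ _ _ _ _ _ _ _ _ _ h)).comp
          (finPairToAdelic (Fp L) L (IsCMField.complexConj L) N' 1 (Matrix.diagonal dV₁) (Matrix.diagonal dW)))
        (ĉ.comp
          ((MonoidHom.noncommCoprod (UnitaryGroup.adelicInl (Fp L) L (IsCMField.complexConj L) N' 1 (Matrix.diagonal dV₁) (Matrix.diagonal dW))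
              (UnitaryGroup.adelicInr (Fp L) L (IsCMField.complexConj L) N' 1 (Matrix.diagonal dV₁) (Matrix.diagonal dW))
              (UnitaryGroup.commute_adelicInl_adelicInr (Fp L) L (IsCMField.complexConj L) N' 1 (Matrix.diagonal dV₁) (Matrix.diagonal dW))).comp
            (finPairToAdelic (Fp L) L (IsCMField.complexConj L) N' 1 (Matrix.diagonal dV₁) (Matrix.diagonal dW)))) := by
    rw [hĉ]
    exact pairSmall₁_twist_comp_finPairToAdelic (Fp L) L (IsCMField.complexConj L) N' 1 e₁ (Matrix.diagonal dV₁) (Matrix.diagonal dW) _ ĉ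
  obtain ⟨T, hTmk, hTlaw⟩ := exists_weilCoinv_equiv_reference (Fp L) L (IsCMField.complexConj L) N' 1 e₁ (Matrix.diagonal dV₁) (Matrix.diagonal dW)
    (complexConj_imagUnit L) (imagUnit_ne_zero L) (imagUnit_mul_self L) (realDiagonal_isSymm L dV₁ hdV₁) (realDiagonal_isSymm L dW hdW)
    (isUnit_det_realDiagonal L dV₁ hdV₁ hdV₁0) (isUnit_det_realDiagonal L dW hdW hdW0) (realDiagonal_map L dV₁ hdV₁).symm
    (realDiagonal_map L dW hdW).symm hproj hχtw hs (χ' := χ') (χ'' := ((ĉ.comp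
          ((MonoidHom.noncommCoprod (UnitaryGroup.adelicInl (Fp L) L (IsCMField.complexConj L) N' 1 (Matrix.diagonal dV₁) (Matrix.diagonal dW))
              (UnitaryGroup.adelicInr (Fp L) L (IsCMField.complexConj L) N' 1 (Matrix.diagonal dV₁) (Matrix.diagonal dW))
              (UnitaryGroup.commute_adelicInl_adelicInr (Fp L) L (IsCMField.complexConj L) N' 1 (Matrix.diagonal dV₁) (Matrix.diagonal dW))).comp
            (finPairToAdelic (Fp L) L (IsCMField.complexConj L) N' 1 (Matrix.diagonal dV₁) (Matrix.diagonal dW)))).comp (MonoidHom.inr _ _))⁻¹ * χ')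
    (fun u => by simp only [MonoidHom.mul_apply, MonoidHom.inv_apply, MonoidHom.comp_apply, MonoidHom.inr_apply, mul_inv_cancel_left])
  refine ⟨ĉ, hĉ, ?_, ?_, hĉc (continuous_splittingOf _ _ _ _ _ _ _ _ _ _ _ _ _ _ _ _ _ h)
    (continuous_chiSplitting L e₁ dV₁ hdV₁ hdV₁0 dW hdW hdW0 θ hθu hθs), T, hTmk, hTlaw⟩
  · rintro _ ⟨γ, rfl⟩
    exact hĉrat _ (UnitaryGroup.adelicInl_toAdelic_mem_range (Fp L) L (IsCMField.complexConj L) N' 1 (Matrix.diagonal dV₁)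
      (Matrix.diagonal dW) γ)
  · rintro _ ⟨γ, rfl⟩
    exact hĉrat _ (UnitaryGroup.adelicInr_toAdelic_mem_range (Fp L) L (IsCMField.complexConj L) N' 1 (Matrix.diagonal dV₁)
      (Matrix.diagonal dW) γ)

end Summit.HodgeConjecture.HodgeConjecture.Cruxes.H413.ThetaJunction

end
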